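import Literature.NumberTheory.EllipticCurves.HeegnerEnvelopeDescentProofs
import Literature.NumberTheory.EllipticCurves.HeegnerEnvelopeReverseTwistedProofs
import HarnessLib

/-!
# The Heegner-module envelope, REVERSE direction for a COHERENT pair `(C, F)` at the Kummer level:
# `(conj_{γ^{p^δ}} − 1)·κ_k ∈ ℋ̄_k(F)` from the point identities, hence `ω_δ · Λκ_∞(C) ⊆ ℋ_∞(F)`
# (CGLS 2022 Rem. 4.1.4; Howard 2004 §3.3; proofs file)

Topic `NumberTheory/EllipticCurves`. THEOREMS ONLY (no definition, no named fact, no `sorry`); sequel of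
`HeegnerEnvelopeReverseProofs` (seat x9-p2, p613966), `HeegnerEnvelopeReverseTwistedProofs` (seat x9-p1-w2:
the twisted levelwise ⟹ Λ-adic step, consumed here by name) and `CompactSelmerTowerNormProofs`. Written by the cell
`bsd-print-x9` seat `bsd-line-x9-p2` for the stub `stub_envelopeTied` of crux stmt-BirchSwinnertonDyer-26359
`PrintX9.HowardContainmentLightFramePinnedOfPrint` and its rev-27 successor (module-level letter
`Stmt.envelopeModulesTied`: `… ∧ g ≠ 0 ∧ g • stabilizedHeegnerModule D C ≤ heegnerModule D F`).

THE POINT. The untwisted levelwise membership `p^e · κ_k ∈ ℋ̄_k(F)` asked by `HeegnerEnvelopeReverseProofs` is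
FALSE in general: solving Howard's family for CGLS's points by the triangular system
(P3) `z_j = a_j • u_j + b_j • v_j` (`p ∤ a_j`), (P1′) `v_{j+1} = a′_j • u_j + b′_j • v_j` (`j > δ`) ends at the
bottom term `v_{δ+1}`, a `K_δ`-RATIONAL point (P1‴) which is not in `ℋ̄_k(F)`. The twist `γ^{p^δ} − 1` kills
exactly that term. So: LEVELWISE `(conj_{γ^{p^δ}} − 1)·κ_k ∈ ℋ̄_k(F)` for every `k > δ` (§2, at the level of
KUMMER FAMILIES, directly from the point identities), and Λ-ADICALLY `ω_δ · Λκ_∞(C) ⊆ ℋ_∞(F)` with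
`ω_δ = (1+T)^{p^δ} − 1 ≠ 0` (§3, through x9-p1-w2's `omega_smul_stabilizedHeegnerModule_le_heegnerModule_of_twisted_generators`)
— the `g` of the module-level envelope.

WHAT.
* §2 `conjPi_sub_self_kummer_uv_mem_heegnerModuleLayer` (the triangular solve, by induction on the layer index)
  and `conjPi_sub_self_mem_heegnerModuleLayer_of_mem_stabilizedClassLayer`.
* §3 **`omega_smul_stabilizedHeegnerModule_le_heegnerModule_of_coherent`** and the `∃ g ≠ 0` packaging
  `exists_ne_zero_smul_stabilizedHeegnerModule_le_heegnerModule_of_coherent`.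
HONEST FRAMING: Kummer-theoretic bookkeeping of printed point identities; nothing about any particular curve; BSD
is not proved by any of this.

References: [CastellaGrossiLeeSkinner2022] Rem. 4.1.4 («`κ_∞` and `κ₁^{Hg}` generate the same `Λ`-submodule»;
arXiv:2008.02571v2 TeX L2278–2294); [Howard2004HeegnerKolyvagin] §3.3 (`H_k`), Thm. 3.3.7; [PerrinRiou1987BSMF]
§3.4 Prop. 10; [Washington1997] §13.2 (`ω_n`).
-/

set_option autoImplicit false

noncomputable section

open scoped Classical Pointwise

open WeierstrassCurve Literature.NumberTheory.EllipticCurves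
  Literature.NumberTheory.EllipticCurves.CastellaGrossiLeeSkinner2022 PowerSeries

universe u

namespace Literature.NumberTheory.EllipticCurves

/-! ## §2 The triangular solve: `(conj_{γ^{p^δ}} − 1)·δ(u_j), (conj_{γ^{p^δ}} − 1)·δ(v_j) ∈ ℋ̄_k(F)` -/

section Triangular

variable {N : ℕ} [NeZero N] {W : WeierstrassCurve ℚ} [W.IsGloballyMinimal] [W.IsElliptic] {K : Type u}
  [Field K] [NumberField K] {p : ℕ} [Fact p.Prime] {κ : ZpExtension K p} {γ : Field.absoluteGaloisGroup K}
  {jbar : AlgebraicClosure K →+* ℂ} (F : HeegnerFamily N W K κ jbar) (C : StabilizedHeegnerData N W K κ jbar)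

omit [NeZero N] [W.IsGloballyMinimal] [W.IsElliptic] [NumberField K] in
/-- An integer prime to `p` is a unit of `ℤ_p`. [cite: Washington1997, §13.2 (ℤ_p)] -/
theorem isUnit_intCast_padicInt_of_not_dvd {a : ℤ} (ha : ¬ (p : ℤ) ∣ a) : IsUnit ((a : ℤ) : ℤ_[p]) := by
  rw [PadicInt.isUnit_iff]
  exact le_antisymm (PadicInt.norm_le_one _) (not_lt.mp fun h ↦ ha ((PadicInt.norm_int_lt_one_iff_dvd a).mp h))

omit [W.IsGloballyMinimal] [W.IsElliptic] in
/-- A Kummer family over `K_k` of a generator `w ∈ {y, z_0, …, z_k}` lies in `ℋ̄_k(F)`.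
[cite: Howard2004HeegnerKolyvagin, §3.3 (H_k = ℤ_p[Gal(K_k/K)]·{y_K, z_0, …, z_k})] -/
theorem mem_heegnerModuleLayer_of_isKummerFamilyOver_generator (γ : Field.absoluteGaloisGroup K) (k : ℕ)
    {w : geomPoints (W.baseChange K)} (hw : w ∈ F.generators k)
    {d : (W.baseChange K).torsionH1Pi p (κ.layerSubgroup k)}
    (hd : (W.baseChange K).IsKummerFamilyOver p (κ.layerSubgroup k)
      (fun _ hσ ↦ F.smul_eq_of_mem_generators hw hσ) d) :
    d ∈ heegnerModuleLayer γ F k := by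
  refine AddSubgroup.subset_closure ⟨1, 0, w, hw, d, hd, ?_⟩
  rw [pow_zero, conjPi_one, padicPi_one]

omit [W.IsGloballyMinimal] in
/-- **The triangular solve.** Let `k > δ`. Suppose (P3) `z_j = a_j • u_j + b_j • v_j` with `p ∤ a_j` for
`δ < j`, (P1′) `v_{j+1} = a′_j • u_j + b′_j • v_j` for `δ < j`, and (P1‴) `v_{δ+1}` is `K_δ`-rational. Then for
every `δ < j ≤ k` and Kummer families `du, dv` of `u_j, v_j` over `K_k`:
`conj_{γ^{p^δ}} du − du ∈ ℋ̄_k(F)` and `conj_{γ^{p^δ}} dv − dv ∈ ℋ̄_k(F)` (induction on `j`; `a_j` is a unit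
of `ℤ_p`, `ℋ̄_k(F)` is `ℤ_p[G_k]`-stable and contains `δ(z_j)`).
[cite: CastellaGrossiLeeSkinner2022, Rem. 4.1.4] [cite: Howard2004HeegnerKolyvagin, §3.3] -/
theorem conjPi_sub_self_kummer_uv_mem_heegnerModuleLayer (hγ : κ.IsTopGenerator γ)
    (hz : ∀ j, C.depth < j → ∃ a b : ℤ, ¬ (p : ℤ) ∣ a ∧ F.z j = a • C.u j + b • C.v j)
    (hv1 : ∀ j, C.depth < j → ∃ a b : ℤ, C.v (j + 1) = a • C.u j + b • C.v j)
    (hvδ : ∀ σ ∈ κ.layerSubgroup C.depth, σ • C.v (C.depth + 1) = C.v (C.depth + 1))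
    {k : ℕ} :
    ∀ (t j : ℕ), j = C.depth + 1 + t → j ≤ k →
      ∀ {hu : ∀ σ ∈ κ.layerSubgroup k, σ • C.u j = C.u j} {hv : ∀ σ ∈ κ.layerSubgroup k, σ • C.v j = C.v j}
        {du dv : (W.baseChange K).torsionH1Pi p (κ.layerSubgroup k)},
        (W.baseChange K).IsKummerFamilyOver p (κ.layerSubgroup k) hu du →
        (W.baseChange K).IsKummerFamilyOver p (κ.layerSubgroup k) hv dv →
        (W.baseChange K).conjPi p (κ.layerSubgroup k) (γ ^ p ^ C.depth) du - du ∈ heegnerModuleLayer γ F k ∧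
          (W.baseChange K).conjPi p (κ.layerSubgroup k) (γ ^ p ^ C.depth) dv - dv ∈ heegnerModuleLayer γ F k := by
  -- from `T(dv) ∈ ℋ̄_k` to `T(du) ∈ ℋ̄_k` through (P3) at `j`
  have hU : ∀ (j : ℕ), C.depth < j → j ≤ k →
      ∀ {hu : ∀ σ ∈ κ.layerSubgroup k, σ • C.u j = C.u j} {hv : ∀ σ ∈ κ.layerSubgroup k, σ • C.v j = C.v j}
        {du dv : (W.baseChange K).torsionH1Pi p (κ.layerSubgroup k)},
        (W.baseChange K).IsKummerFamilyOver p (κ.layerSubgroup k) hu du →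
        (W.baseChange K).IsKummerFamilyOver p (κ.layerSubgroup k) hv dv →
        (W.baseChange K).conjPi p (κ.layerSubgroup k) (γ ^ p ^ C.depth) dv - dv ∈ heegnerModuleLayer γ F k →
        (W.baseChange K).conjPi p (κ.layerSubgroup k) (γ ^ p ^ C.depth) du - du ∈ heegnerModuleLayer γ F k := by
    intro j hj hjk hu hv du dv hdu hdv hTv
    obtain ⟨a, b, ha, hzj⟩ := hz j hj
    have hzgen : F.z j ∈ F.generators k := Set.mem_union_right _ ⟨j, hjk, rfl⟩
    obtain ⟨dz, hdz⟩ := exists_isKummerFamilyOver (W.baseChange K) p (κ.layerSubgroup k) (F.z j)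
      (fun σ hσ ↦ F.smul_eq_of_mem_generators hzgen hσ)
    have hdzmem : dz ∈ heegnerModuleLayer γ F k :=
      mem_heegnerModuleLayer_of_isKummerFamilyOver_generator F γ k hzgen hdz
    have hcomb := IsKummerFamilyOver.add p (IsKummerFamilyOver.zsmul hdu a) (IsKummerFamilyOver.zsmul hdv b)
    have heq : dz = a • du + b • dv := IsKummerFamilyOver.unique p hdz (IsKummerFamilyOver.of_eq hzj.symm hcomb)
    -- `T(a • du) = T(dz) − b • T(dv) ∈ ℋ̄_k`
    have hTadu : (W.baseChange K).conjPi p (κ.layerSubgroup k) (γ ^ p ^ C.depth) (a • du) - a • du ∈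
        heegnerModuleLayer γ F k := by
      have h : (W.baseChange K).conjPi p (κ.layerSubgroup k) (γ ^ p ^ C.depth) (a • du) - a • du =
          ((W.baseChange K).conjPi p (κ.layerSubgroup k) (γ ^ p ^ C.depth) dz - dz) -
            b • ((W.baseChange K).conjPi p (κ.layerSubgroup k) (γ ^ p ^ C.depth) dv - dv) := by
        rw [heq, map_add, map_zsmul, map_zsmul, zsmul_sub]
        abel
      rw [h]
      exact (heegnerModuleLayer γ F k).sub_mem
        ((heegnerModuleLayer γ F k).sub_mem (conjPi_pow_mem_heegnerModuleLayer γ F k _ hdzmem) hdzmem)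
        (zsmul_mem_heegnerModuleLayer γ F k b hTv)
    -- divide by the unit `a`
    have hunit : IsUnit ((a : ℤ) : ℤ_[p]) := isUnit_intCast_padicInt_of_not_dvd ha
    have h2 : (W.baseChange K).conjPi p (κ.layerSubgroup k) (γ ^ p ^ C.depth) du - du =
        (W.baseChange K).padicPi p (κ.layerSubgroup k) (Ring.inverse ((a : ℤ) : ℤ_[p]))
          ((W.baseChange K).conjPi p (κ.layerSubgroup k) (γ ^ p ^ C.depth) (a • du) - a • du) := by
      rw [map_sub, ← padicPi_intCast, ← conjPi_padicPi_comm]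
      simp only [padicPi_ringInverse_mul _ _ _ hunit]
    rw [h2]
    exact padicPi_mem_heegnerModuleLayer γ F k _ hTadu
  intro t
  induction t with
  | zero =>
    intro j hj hjk hu hv du dv hdu hdv
    obtain rfl : j = C.depth + 1 := by simpa using hj
    -- `v_{δ+1}` is `K_δ`-rational: the twist kills its Kummer family
    have hTv : (W.baseChange K).conjPi p (κ.layerSubgroup k) (γ ^ p ^ C.depth) dv - dv ∈
        heegnerModuleLayer γ F k := by
      have hconj := IsKummerFamilyOver.conjPi (γ ^ p ^ C.depth) hdv
      have hfix : γ ^ p ^ C.depth • C.v (C.depth + 1) = C.v (C.depth + 1) :=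
        hvδ _ (LambdaAdicSelmerDataExists.pow_mem_layerSubgroup p κ hγ C.depth)
      rw [IsKummerFamilyOver.unique p (IsKummerFamilyOver.of_eq hfix hconj) hdv, sub_self]
      exact (heegnerModuleLayer γ F k).zero_mem
    exact ⟨hU _ (Nat.lt_succ_self _) hjk hdu hdv hTv, hTv⟩
  | succ t ih =>
    intro j hj hjk hu hv du dv hdu hdv
    have hjd' : C.depth < C.depth + 1 + t := by omega
    have hjd : C.depth < j := by omega
    have hu₁ : ∀ σ ∈ κ.layerSubgroup k, σ • C.u (C.depth + 1 + t) = C.u (C.depth + 1 + t) :=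
      fun σ hσ ↦ C.smul_u_eq hjd' (κ.layerSubgroup_antitone (by omega) hσ)
    have hv₁ : ∀ σ ∈ κ.layerSubgroup k, σ • C.v (C.depth + 1 + t) = C.v (C.depth + 1 + t) :=
      fun σ hσ ↦ C.smul_v_eq hjd' (κ.layerSubgroup_antitone (by omega) hσ)
    obtain ⟨du₁, hdu₁⟩ := exists_isKummerFamilyOver (W.baseChange K) p (κ.layerSubgroup k) _ hu₁
    obtain ⟨dv₁, hdv₁⟩ := exists_isKummerFamilyOver (W.baseChange K) p (κ.layerSubgroup k) _ hv₁
    obtain ⟨hTu₁, hTv₁⟩ := ih _ rfl (by omega) hdu₁ hdv₁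
    -- `v_j = a' • u_{j-1} + b' • v_{j-1}`
    obtain ⟨a', b', hv'⟩ := hv1 _ hjd'
    have hvj : C.v j = a' • C.u (C.depth + 1 + t) + b' • C.v (C.depth + 1 + t) := by rw [hj]; exact hv'
    have heqv : dv = a' • du₁ + b' • dv₁ :=
      IsKummerFamilyOver.unique p (IsKummerFamilyOver.of_eq hvj hdv)
        (IsKummerFamilyOver.add p (IsKummerFamilyOver.zsmul hdu₁ _) (IsKummerFamilyOver.zsmul hdv₁ _))
    have hTv : (W.baseChange K).conjPi p (κ.layerSubgroup k) (γ ^ p ^ C.depth) dv - dv ∈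
        heegnerModuleLayer γ F k := by
      have h : (W.baseChange K).conjPi p (κ.layerSubgroup k) (γ ^ p ^ C.depth) dv - dv =
          a' • ((W.baseChange K).conjPi p (κ.layerSubgroup k) (γ ^ p ^ C.depth) du₁ - du₁) +
            b' • ((W.baseChange K).conjPi p (κ.layerSubgroup k) (γ ^ p ^ C.depth) dv₁ - dv₁) := by
        rw [heqv, map_add, map_zsmul, map_zsmul, zsmul_sub, zsmul_sub]
        abel
      rw [h]
      exact (heegnerModuleLayer γ F k).add_mem (zsmul_mem_heegnerModuleLayer γ F k a' hTu₁)
        (zsmul_mem_heegnerModuleLayer γ F k b' hTv₁)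
    exact ⟨hU _ hjd hjk hdu hdv hTv, hTv⟩

/-- **`(conj_{γ^{p^δ}} − 1)·κ_k ∈ ℋ̄_k(F)`** for every `k > δ` and every representative of CGLS's class
`δ(κ_k) = α^{-d(k)}·(δ(u_k) − α⁻¹δ(v_k))`, under (P3) with `p ∤ a_j`, (P1′) and (P1‴).
[cite: CastellaGrossiLeeSkinner2022, Rem. 4.1.4 (κ_k)] [cite: Howard2004HeegnerKolyvagin, §3.3] -/
theorem conjPi_sub_self_mem_heegnerModuleLayer_of_mem_stabilizedClassLayer (hγ : κ.IsTopGenerator γ)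
    (hz : ∀ j, C.depth < j → ∃ a b : ℤ, ¬ (p : ℤ) ∣ a ∧ F.z j = a • C.u j + b • C.v j)
    (hv1 : ∀ j, C.depth < j → ∃ a b : ℤ, C.v (j + 1) = a • C.u j + b • C.v j)
    (hvδ : ∀ σ ∈ κ.layerSubgroup C.depth, σ • C.v (C.depth + 1) = C.v (C.depth + 1))
    {k : ℕ} (hk : C.depth < k) {x : (W.baseChange K).torsionH1Pi p (κ.layerSubgroup k)}
    (hx : x ∈ stabilizedClassLayer C k hk) :
    (W.baseChange K).conjPi p (κ.layerSubgroup k) (γ ^ p ^ C.depth) x - x ∈ heegnerModuleLayer γ F k := by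
  obtain ⟨du, dv, hdu, hdv, rfl⟩ := hx
  obtain ⟨hTu, hTv⟩ := conjPi_sub_self_kummer_uv_mem_heegnerModuleLayer F C hγ hz hv1 hvδ (k - (C.depth + 1))
    k (by omega) le_rfl (hu := fun σ hσ ↦ C.smul_u_eq hk hσ) (hv := fun σ hσ ↦ C.smul_v_eq hk hσ) hdu hdv
  have h : (W.baseChange K).conjPi p (κ.layerSubgroup k) (γ ^ p ^ C.depth)
        ((W.baseChange K).padicPi p (κ.layerSubgroup k) (Ring.inverse (unitRoot W p) ^ C.d k)
          (du - (W.baseChange K).padicPi p (κ.layerSubgroup k) (Ring.inverse (unitRoot W p)) dv)) -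
        (W.baseChange K).padicPi p (κ.layerSubgroup k) (Ring.inverse (unitRoot W p) ^ C.d k)
          (du - (W.baseChange K).padicPi p (κ.layerSubgroup k) (Ring.inverse (unitRoot W p)) dv) =
      (W.baseChange K).padicPi p (κ.layerSubgroup k) (Ring.inverse (unitRoot W p) ^ C.d k)
        (((W.baseChange K).conjPi p (κ.layerSubgroup k) (γ ^ p ^ C.depth) du - du) -
          (W.baseChange K).padicPi p (κ.layerSubgroup k) (Ring.inverse (unitRoot W p))
            ((W.baseChange K).conjPi p (κ.layerSubgroup k) (γ ^ p ^ C.depth) dv - dv)) := by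
    rw [conjPi_padicPi_comm, ← map_sub, map_sub ((W.baseChange K).conjPi p (κ.layerSubgroup k) _),
      conjPi_padicPi_comm, map_sub ((W.baseChange K).padicPi p (κ.layerSubgroup k) (Ring.inverse (unitRoot W p)))]
    congr 1
    abel
  rw [h]
  exact padicPi_mem_heegnerModuleLayer γ F k _ ((heegnerModuleLayer γ F k).sub_mem hTu
    (padicPi_mem_heegnerModuleLayer γ F k _ hTv))

end Triangular

/-! ## §3 The reverse envelope `ω_δ • Λκ_∞(C) ≤ ℋ_∞(F)` -/

section Envelope

variable {N : ℕ} [NeZero N] {W : WeierstrassCurve ℚ} [W.IsGloballyMinimal] [W.IsElliptic] {K : Type u}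
  [Field K] [NumberField K] {p : ℕ} [Fact p.Prime] {κ : ZpExtension K p} {γ : Field.absoluteGaloisGroup K}
  {jbar : AlgebraicClosure K →+* ℂ} (D : (W.baseChange K).LambdaAdicSelmerData κ γ)
  (F : HeegnerFamily N W K κ jbar) (C : StabilizedHeegnerData N W K κ jbar)

/-- **THE REVERSE ENVELOPE WITH THE TWIST: `ω_δ • Λκ_∞(C) ≤ ℋ_∞(F)`** (`ω_δ = (1+T)^{p^δ} − 1`) for a coherent
pair `(C, F)`: (P3) `z_j = a_j • u_j + b_j • v_j` with `p ∤ a_j` (`j > δ`), (P1′) `v_{j+1} = a′_j • u_j + b′_j • v_j`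
(`j > δ`), (P1‴) `v_{δ+1}` is `K_δ`-rational; `γ` a topological generator. The direction `Λκ ⊆ ℋ` of «`κ_∞` and
`κ₁^{Hg}` generate the same `Λ`-submodule» (CGLS Rem. 4.1.4), up to the factor `ω_δ` which accounts for the
layers `k ≤ δ` (where `Λκ_∞(C)` imposes nothing) and for the `K_δ`-rational bottom term of the triangular solve.
[cite: CastellaGrossiLeeSkinner2022, Rem. 4.1.4 (arXiv:2008.02571v2 TeX L2278–2294)]
[cite: Howard2004HeegnerKolyvagin, §3.3 and Thm. 3.3.7] [cite: PerrinRiou1987BSMF, §3.4 Prop. 10] -/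
theorem omega_smul_stabilizedHeegnerModule_le_heegnerModule_of_coherent (hγ : κ.IsTopGenerator γ)
    (hz : ∀ j, C.depth < j → ∃ a b : ℤ, ¬ (p : ℤ) ∣ a ∧ F.z j = a • C.u j + b • C.v j)
    (hv1 : ∀ j, C.depth < j → ∃ a b : ℤ, C.v (j + 1) = a • C.u j + b • C.v j)
    (hvδ : ∀ σ ∈ κ.layerSubgroup C.depth, σ • C.v (C.depth + 1) = C.v (C.depth + 1)) :
    (((1 + PowerSeries.X : IwasawaAlgebra p) ^ (p ^ C.depth)) - 1) • stabilizedHeegnerModule D C ≤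
      heegnerModule D F :=
  omega_smul_stabilizedHeegnerModule_le_heegnerModule_of_twisted_generators D F C hγ fun _ hk _ hx ↦
    conjPi_sub_self_mem_heegnerModuleLayer_of_mem_stabilizedClassLayer F C hγ hz hv1 hvδ hk hx

/-- **The reverse envelope, `∃ g ≠ 0` packaging** (the shape of the module-level stub letter
`Stmt.envelopeModulesTied`): `∃ g : Λ, g ≠ 0 ∧ g • Λκ_∞(C) ≤ ℋ_∞(F)` (`g = ω_δ`, non-zero since its reduction
mod `p` is `T^{p^δ} ≠ 0`). [cite: CastellaGrossiLeeSkinner2022, Rem. 4.1.4] [cite: Washington1997, §13.2 (ω_n)] -/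
theorem exists_ne_zero_smul_stabilizedHeegnerModule_le_heegnerModule_of_coherent (hγ : κ.IsTopGenerator γ)
    (hz : ∀ j, C.depth < j → ∃ a b : ℤ, ¬ (p : ℤ) ∣ a ∧ F.z j = a • C.u j + b • C.v j)
    (hv1 : ∀ j, C.depth < j → ∃ a b : ℤ, C.v (j + 1) = a • C.u j + b • C.v j)
    (hvδ : ∀ σ ∈ κ.layerSubgroup C.depth, σ • C.v (C.depth + 1) = C.v (C.depth + 1)) :
    ∃ g : IwasawaAlgebra p, g ≠ 0 ∧ g • stabilizedHeegnerModule D C ≤ heegnerModule D F := by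
  exact ⟨((1 + PowerSeries.X : IwasawaAlgebra p) ^ (p ^ C.depth)) - 1, omega_ne_zero C.depth,
    omega_smul_stabilizedHeegnerModule_le_heegnerModule_of_coherent D F C hγ hz hv1 hvδ⟩

end Envelope

end Literature.NumberTheory.EllipticCurves

end
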